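import Summits.MatrixMultiplication.OmegaCensus.ThreeSetLineModFourSliceParity
import Summits.MatrixMultiplication.OmegaCensus.ThreeSetLineModFourSliceLemmas
import Summits.MatrixMultiplication.OmegaCensus.ThreeSetLineUnitObstruction
import Mathlib.RingTheory.AdjoinRoot
import HarnessLib

/-!
# The bit-sliced MOD-4 FILTER, XI: the algebra of the parity-local obstruction (`𝔽₂[X]/(X^n + m)`, LFSR, the kill rule)

ω-census `pub-omega`, family (b3), seat pub-omega-group gen 42.  Framing: lottery ticket; floor = certified bounds/negative
ranges.  VALUE: a kernel TOOL for the three-set cube cells `(4, d, e)@p²` (`ThreeSetZpCells4Core`); NOT progress on ω.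
`F2R n m = AdjoinRoot (X^n + m)` over `𝔽₂` (`binPoly`), root `rt`; `rt^v = ofMask (lfsr n m v)` (`rt_pow_eq_ofMask`, one LFSR step is
multiplication by `rt`); `Σ_{i<p} rt^i = 0` from the XOR-fold check (`geom_sum_rt_eq_zero`); `lev (rt^a) F` in coordinates
(`lev_rt_pow_eq`: odd counts), `levc (rt^a) = lev (rt^{p−a})`; and the kill rule `no_line_identity3_of_lev_levc_zero`
(`x(ρ) = x(ρ⁻¹) = 0`, `Σ ρ^i = 0`, nontrivial ring ⇒ no solution), via `LineUnit.line_char_identity3`.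
-/

namespace Summit.MatrixMultiplication.OmegaCensus

/-! # The parity-local obstruction: algebra in `𝔽₂[X]/(X^n + m)` -/

namespace LineMod

open Finset Polynomial

/-- The binary polynomial `X^n + Σ_{b<n, bit b of m} X^b` over `𝔽₂`. [folklore] -/
noncomputable def binPoly (n m : ℕ) : (ZMod 2)[X] := X ^ n + ∑ b ∈ range n, if m.testBit b then X ^ b else 0

/-- The ring `𝔽₂[X]/(X^n + m)`. [folklore] -/
abbrev F2R (n m : ℕ) : Type := AdjoinRoot (binPoly n m)

/-- Its generator `r = X mod (X^n + m)`. [folklore] -/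
noncomputable def rt (n m : ℕ) : F2R n m := AdjoinRoot.root (binPoly n m)

/-- Characteristic `2`: `x + x = 0`. [folklore] -/
theorem add_self_F2R {n m : ℕ} (x : F2R n m) : x + x = 0 := by
  have h2 : (2 : F2R n m) = 0 := by
    rw [← map_ofNat (algebraMap (ZMod 2) (F2R n m)) 2, show (OfNat.ofNat 2 : ZMod 2) = 0 from rfl, map_zero]
  rw [← two_mul, h2, zero_mul]

/-- In characteristic `2`, `−x = x`. [folklore] -/
theorem neg_eq_self_F2R {n m : ℕ} (x : F2R n m) : -x = x := by
  rw [neg_eq_iff_add_eq_zero, add_self_F2R]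

/-- A natural number cast into `F2R` only depends on its parity. [folklore] -/
theorem natCast_F2R {n m : ℕ} (k : ℕ) : (k : F2R n m) = if k % 2 = 1 then 1 else 0 := by
  induction k with
  | zero => simp
  | succ k ih =>
    rw [Nat.cast_succ, ih]
    rcases Nat.mod_two_eq_zero_or_one k with h | h
    · rw [if_neg (by omega), if_pos (by omega), zero_add]
    · rw [if_pos h, if_neg (by omega), ← two_mul, mul_one,
        ← map_ofNat (algebraMap (ZMod 2) (F2R n m)) 2, show (OfNat.ofNat 2 : ZMod 2) = 0 from rfl, map_zero]

/-- The element of `F2R` with coordinate mask `c`: `Σ_{b<n, bit b of c} r^b`. [folklore] -/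
noncomputable def ofMask (n m c : ℕ) : F2R n m := ∑ b ∈ range n, if c.testBit b then rt n m ^ b else 0

/-- The defining relation: `r^n = ofMask m`. [folklore] -/
theorem rt_pow_n (n m : ℕ) : rt n m ^ n = ofMask n m m := by
  have h0 : AdjoinRoot.mk (binPoly n m) (X ^ n + ∑ b ∈ range n, if m.testBit b then X ^ b else 0) = 0 :=
    AdjoinRoot.mk_self
  rw [map_add, map_pow, AdjoinRoot.mk_X, map_sum] at h0
  have h1 : (∑ b ∈ range n, AdjoinRoot.mk (binPoly n m) (if m.testBit b then X ^ b else 0)) = ofMask n m m := by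
    unfold ofMask rt
    refine sum_congr rfl fun b _ => ?_
    split
    · rw [map_pow, AdjoinRoot.mk_X]
    · rw [map_zero]
  rw [h1] at h0
  unfold rt
  rw [eq_neg_of_add_eq_zero_left h0, neg_eq_self_F2R]

/-- `ofMask` is additive under XOR (characteristic `2`). [folklore] -/
theorem ofMask_xor (n m c c' : ℕ) : ofMask n m (c ^^^ c') = ofMask n m c + ofMask n m c' := by
  unfold ofMask
  rw [← sum_add_distrib]
  refine sum_congr rfl fun b _ => ?_
  rw [Nat.testBit_xor]
  cases c.testBit b <;> cases c'.testBit b <;> simp [add_self_F2R]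

/-- `ofMask (2^n) = 0` (no coordinate below `n`). [folklore] -/
theorem ofMask_two_pow (n m : ℕ) : ofMask n m (2 ^ n) = 0 := by
  unfold ofMask
  refine sum_eq_zero fun b hb => ?_
  rw [Nat.testBit_two_pow]
  simp [(mem_range.1 hb).ne']

/-- `ofMask 1 = 1` (when `n ≥ 1`). [folklore] -/
theorem ofMask_one {n : ℕ} (m : ℕ) (hn : 0 < n) : ofMask n m 1 = 1 := by
  unfold ofMask
  rw [sum_eq_single_of_mem 0 (mem_range.2 hn) fun b _ hb => by
    rw [show (1 : ℕ) = 2 ^ 0 from rfl, Nat.testBit_two_pow]; simp [Ne.symm hb]]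
  simp

/-- Multiplication by `r` before reduction: `r · ofMask c = ofMask (c <<< 1) + [bit (n−1) of c]·r^n`. [folklore] -/
theorem rt_mul_ofMask {n : ℕ} (m c : ℕ) (hn : 0 < n) :
    rt n m * ofMask n m c = ofMask n m (c <<< 1) + if c.testBit (n - 1) then rt n m ^ n else 0 := by
  obtain ⟨n', rfl⟩ : ∃ n', n = n' + 1 := ⟨n - 1, by omega⟩
  unfold ofMask
  rw [mul_sum, sum_range_succ, sum_range_succ', Nat.testBit_shiftLeft, Nat.add_sub_cancel]
  simp only [ge_iff_le, nonpos_iff_eq_zero, one_ne_zero, decide_false, Bool.false_and, Bool.false_eq_true, if_false, add_zero]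
  congr 1
  · refine sum_congr rfl fun b _ => ?_
    rw [Nat.testBit_shiftLeft]
    simp only [ge_iff_le, Nat.le_add_left, decide_true, Bool.true_and, Nat.add_sub_cancel]
    split
    · rw [pow_succ]; ring
    · rw [mul_zero]
  · split
    · rw [pow_succ]; ring
    · rw [mul_zero]

/-- **One LFSR step is multiplication by `r`.** [folklore] -/
theorem ofMask_lfsrStep {n : ℕ} (m c : ℕ) (hn : 0 < n) : ofMask n m (lfsrStep n m c) = rt n m * ofMask n m c := by
  rw [rt_mul_ofMask m c hn]
  unfold lfsrStep
  rw [Nat.testBit_shiftLeft]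
  rw [show decide (n ≥ 1) = true from decide_eq_true (by omega), Bool.true_and]
  split
  · rw [ofMask_xor, ofMask_xor, ofMask_two_pow, add_zero, rt_pow_n]
  · rw [add_zero]

/-- **`r^v = ofMask (lfsr v)`.** [folklore] -/
theorem rt_pow_eq_ofMask {n : ℕ} (m : ℕ) (hn : 0 < n) : ∀ v, rt n m ^ v = ofMask n m (lfsr n m v)
  | 0 => by rw [pow_zero, lfsr, ofMask_one m hn]
  | v + 1 => by rw [pow_succ, lfsr, ofMask_lfsrStep m _ hn, rt_pow_eq_ofMask m hn v, mul_comm]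

/-- Bit `b` of the XOR-fold is the parity of the number of `i < cnt` with bit `b` of `lfsr i` set. [folklore] -/
theorem testBit_xorFoldLfsr (n m b : ℕ) : ∀ cnt,
    (xorFoldLfsr n m cnt).testBit b = decide ((∑ i ∈ range cnt, if (lfsr n m i).testBit b then 1 else 0) % 2 = 1)
  | 0 => by simp [xorFoldLfsr]
  | cnt + 1 => by
    rw [xorFoldLfsr, Nat.testBit_xor, testBit_xorFoldLfsr n m b cnt, sum_range_succ]
    set S := ∑ i ∈ range cnt, if (lfsr n m i).testBit b then 1 else 0
    cases (lfsr n m cnt).testBit b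
    · simp
    · simp only [if_true, Bool.xor_true]
      rcases Nat.mod_two_eq_zero_or_one S with h | h
      · rw [show (S + 1) % 2 = 1 by omega, h]; decide
      · rw [show (S + 1) % 2 = 0 by omega, h]; decide

/-- A sum of indicator elements in `F2R` is the parity of the count. [folklore] -/
theorem sum_ite_one_F2R {n m : ℕ} (s : Finset ℕ) (P : ℕ → Prop) [DecidablePred P] :
    (∑ i ∈ s, if P i then (1 : F2R n m) else 0) = ((∑ i ∈ s, if P i then 1 else 0 : ℕ) : F2R n m) := by
  rw [Nat.cast_sum]; refine sum_congr rfl fun i _ => ?_; split <;> simp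

/-- **The geometric sum vanishes** when the XOR-fold check passes: `Σ_{i<p} r^i = 0`. [folklore] -/
theorem geom_sum_rt_eq_zero {n m p : ℕ} (hn : 0 < n) (h : xorFoldLfsr n m p = 0) : ∑ i ∈ range p, rt n m ^ i = 0 := by
  have e : ∑ i ∈ range p, rt n m ^ i = ∑ b ∈ range n, ∑ i ∈ range p, if (lfsr n m i).testBit b then rt n m ^ b else 0 := by
    rw [sum_comm]
    refine sum_congr rfl fun i _ => ?_
    rw [rt_pow_eq_ofMask m hn i]; rfl
  rw [e]
  refine sum_eq_zero fun b _ => ?_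
  have hpar := testBit_xorFoldLfsr n m b p
  rw [h, Nat.zero_testBit] at hpar
  have heven : (∑ i ∈ range p, if (lfsr n m i).testBit b then 1 else 0) % 2 = 0 := by
    have hne : ¬ (∑ i ∈ range p, if (lfsr n m i).testBit b then 1 else 0) % 2 = 1 := by
      intro hc; rw [decide_eq_true hc] at hpar; exact Bool.false_ne_true hpar
    omega
  calc ∑ i ∈ range p, (if (lfsr n m i).testBit b then rt n m ^ b else 0)
      = (∑ i ∈ range p, if (lfsr n m i).testBit b then (1 : F2R n m) else 0) * rt n m ^ b := by
        rw [sum_mul]; refine sum_congr rfl fun i _ => ?_; split <;> simp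
    _ = 0 := by rw [sum_ite_one_F2R, natCast_F2R, heven]; simp

end LineMod

/-! # The parity-local obstruction: the kill rule and its sliced evaluation -/

namespace LineMod

open Finset Polynomial

/-- `binPoly n m` has `natDegree n` hence the quotient ring is nontrivial (`n ≥ 1`). [folklore] -/
theorem nontrivial_F2R {n : ℕ} (m : ℕ) (hn : 0 < n) : Nontrivial (F2R n m) := by
  have hlow : (∑ b ∈ range n, if m.testBit b then (X : (ZMod 2)[X]) ^ b else 0).degree < n := by
    refine (degree_sum_le _ _).trans_lt ?_
    refine (Finset.sup_lt_iff (by simp)).2 fun b hb => ?_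
    split
    · rw [degree_X_pow]; exact_mod_cast mem_range.1 hb
    · rw [degree_zero]; exact WithBot.bot_lt_coe _
  have hdeg : (binPoly n m).degree = n := by
    unfold binPoly
    rw [degree_add_eq_left_of_degree_lt (by rwa [degree_X_pow]), degree_X_pow]
  refine AdjoinRoot.nontrivial _ ?_
  rw [hdeg]; exact_mod_cast hn.ne'

section Kill

variable {p : ℕ} [Fact p.Prime]

omit [Fact p.Prime] in
/-- `zch` of a power of the root: `zch (r^a) v = r^{a v}`. [folklore] -/
theorem zch_pow_base {R : Type*} [CommRing R] (r : R) (a : ℕ) (v : ZMod p) : zch (r ^ a) v = r ^ (a * v.val) := by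
  rw [zch, ← pow_mul]

/-- **The local obstruction at a prime above `2`.**  In a nontrivial commutative ring with `Σ_{i<p} ρ^i = 0`: if `Σ_v F(v) ρ^v = 0` and
`Σ_v F(v) ρ^{−v} = 0` then the three-set line identity has no solution (all three terms of `w̄xy + wx̄y + wxȳ = −ρ^s` vanish).
[folklore] -/
theorem no_line_identity3_of_lev_levc_zero {R : Type*} [CommRing R] [Nontrivial R] {ρ : R} (hρ : ∑ i ∈ range p, ρ ^ i = 0)
    (W F : ZMod p → ℕ) (hF : lev ρ F = 0) (hFc : levc ρ F = 0) (G : ZMod p → ℕ) (s : ZMod p) (K : ℕ) :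
    ¬ ∀ τ : ZMod p, (∑ u : ZMod p, lineMat3 W F τ u * G u) + (if s = τ then 1 else 0) = K := by
  intro hid
  have h := LineUnit.line_char_identity3 hρ W F G s K hid
  rw [hF, hFc] at h
  simp only [mul_zero, zero_mul, zero_add] at h
  -- `ρ^s = 0` but `ρ^p = 1`
  have hp1 := pow_eq_one_of_geom_sum_eq_zero hρ
  have hs : s.val ≤ p := (ZMod.val_lt s).le
  have : (ρ : R) ^ p = 0 := by
    rw [← Nat.add_sub_cancel' hs, pow_add]
    unfold zch at h
    rw [h, zero_mul]
  rw [hp1] at this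
  exact one_ne_zero this

/-- The count of odd entries `v < cnt` of `F` whose `lfsr (a v mod p)` has bit `b`. [folklore] -/
def oddCount (p n m a b : ℕ) (F : ℕ → ℕ) (cnt : ℕ) : ℕ :=
  ∑ v ∈ range cnt, if (lfsr n m (a * v % p)).testBit b ∧ F v % 2 = 1 then 1 else 0

/-- **`lev (r^a) F` in coordinates**: `Σ_b (oddCount_b) r^b`. [folklore] -/
theorem lev_rt_pow_eq {n m a : ℕ} (hn : 0 < n) (hgeom : xorFoldLfsr n m p = 0) (F : ZMod p → ℕ) :
    lev (rt n m ^ a) F = ∑ b ∈ range n, (oddCount p n m a b (fun v => F (v : ZMod p)) p : F2R n m) * rt n m ^ b := by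
  haveI : NeZero p := ⟨(Fact.out : p.Prime).ne_zero⟩
  have hp1 : rt n m ^ p = 1 := pow_eq_one_of_geom_sum_eq_zero (geom_sum_rt_eq_zero hn hgeom)
  unfold lev oddCount
  -- each term: (F v) · r^{a v} = [F v odd] · ofMask (lfsr (a v mod p))
  have e1 : ∀ v : ZMod p, (F v : F2R n m) * zch (rt n m ^ a) v =
      ∑ b ∈ range n, (if (lfsr n m (a * v.val % p)).testBit b ∧ F v % 2 = 1 then (1 : F2R n m) else 0) * rt n m ^ b := by
    intro v
    rw [zch_pow_base, ← pow_mod_eq_pow hp1, rt_pow_eq_ofMask m hn, natCast_F2R]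
    unfold ofMask
    rw [mul_sum]
    refine sum_congr rfl fun b _ => ?_
    by_cases h1 : F v % 2 = 1 <;> by_cases h2 : (lfsr n m (a * v.val % p)).testBit b <;> simp [h1, h2]
  rw [Fintype.sum_congr _ _ e1, sum_comm]
  simp_rw [← sum_mul]
  refine sum_congr rfl fun b _ => ?_
  congr 1
  rw [Nat.cast_sum, ← sum_zmod_val' (fun v => ((if (lfsr n m (a * v % p)).testBit b ∧ F (v : ZMod p) % 2 = 1 then 1 else 0 : ℕ) : F2R n m))]
  refine sum_congr rfl fun v _ => ?_
  rw [ZMod.natCast_zmod_val]; split <;> simp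

/-- `levc (r^a) = lev (r^{p−a})` (`0 < a < p`, using `r^p = 1`). [folklore] -/
theorem levc_rt_pow_eq {n m a : ℕ} (hn : 0 < n) (hgeom : xorFoldLfsr n m p = 0) (ha : a < p) (F : ZMod p → ℕ) :
    levc (rt n m ^ a) F = lev (rt n m ^ (p - a)) F := by
  haveI : NeZero p := ⟨(Fact.out : p.Prime).ne_zero⟩
  have hp1 : rt n m ^ p = 1 := pow_eq_one_of_geom_sum_eq_zero (geom_sum_rt_eq_zero hn hgeom)
  unfold levc lev
  refine sum_congr rfl fun v _ => ?_
  congr 1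
  rw [zch_pow_base, zch_pow_base, ← pow_mod_eq_pow hp1, ← pow_mod_eq_pow hp1 ((p - a) * v.val), ZMod.neg_val]
  split_ifs with hv
  · subst hv; simp
  · congr 1
    have hvp := ZMod.val_lt v
    have h1 : a * (p - v.val) + a * v.val = a * p := by rw [← Nat.mul_add, Nat.sub_add_cancel hvp.le]
    have h2 : (p - a) * v.val + a * v.val = p * v.val := by rw [← Nat.add_mul, Nat.sub_add_cancel ha.le]
    have key : a * (p - v.val) ≡ (p - a) * v.val [MOD p] := by
      refine Nat.ModEq.add_right_cancel' (a * v.val) ?_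
      rw [h1, h2]
      exact ((Nat.modEq_zero_iff_dvd.2 (dvd_mul_left p a)).trans (Nat.modEq_zero_iff_dvd.2 (dvd_mul_right p v.val)).symm)
    exact key

end Kill

end LineMod

end Summit.MatrixMultiplication.OmegaCensus
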